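import Summits.BirchSwinnertonDyer.Rank1Residual.F1Sign2.HeegnerCuspSymbolAtTwo
import Literature.NumberTheory.EllipticCurves.BirchFormulaQuadraticSigned
import HarnessLib.Audit.Tags
import HarnessLib

/-!
# Cell `bsd-f1-sign2` — analytic lens (planner `-an` g22; MEMO-an v1.63 §25 + add1–add3; T-an-88): AN-39 «THE KOHNEN–GKZ BRIDGE AT 2» — RM genus sums of minus cusp symbols
# (§39.0 vocabulary; AN-39a `RMGenusSumSymmetry`, AN-39b `RMGenusSumPlueckerRelation`, AN-39c′ `RMHeegnerIndexProductIdentity`, AN-39c₂′ `RMGenusSumExponentLawAtTwo`, AN-39d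
# `RMGenusSumParityLawAtTwo`, AN-39e′ `MinimalRMGenusSumCertifiesTwoDoorsAtTwo`, AN-39f `RMGenusSumFactorisation`, AN-39g `BirchSumSquareClassLaw`, AN-39h′ `BirchSumHeegnerIndexSquareLaw`,
# AN-39i `HeegnerExponentBirchMeterAtTwo`, AN-39j′ `BirchValueKummerLocalisationLawAtTwo`, AN-39k `RMGenusSumSignLaw`; -an's kernel reduction `minimalRMGenusSum_exponents_zero` + REF1 §201's certificates live in the sibling `RMGenusSumAtTwoKernel.lean`)

STATEMENTS ONLY (no theorem: -an's one proved reduction lemma rides in the kernel file, `lint.statement-form` ≤ 400 lines for proof-holding files), typer -ty g18.  Port asked by -an g22 (T-an-88 «port §39.0 vocabulary + AN-39a as `F1Sign2/RMGenusSumAtTwo.lean`», MEMO-an §25.8;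
the v2/v2.2 rows AN-39f–k of add2/add3 ride in the same module), REF-GATED until REF1 g18 §201 (INBOX 2026-08-29T13:50:41Z «PORT GATE R201a/R201b/R201g for T-an-88 and any AN-39 rows»).
Source: `HOME/MEMO-an-data/g22/Sketch_g22.lean` **622a8640800b1e46** (v2.2, 380 l., 12 Props + 1 lemma + vocabulary; -an's batteries `g22/bc/Probe_g22{,b}.txt` P1–P5 10/10 CLEAN) and REF1's
`HOME/REF1-data/b201/lean/Probe201.lean` **b3431c39b55fe87b** (= the sketch VERBATIM under `…ANg22.REF1s201` + 12 sorry probes + 12 sorry-free REF1 decls incl. the kernel witness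
`heegnerPointComplex_twiceDatum`; farm rc 0 · exactly 12 sorries · axioms std).  Namespace `…F1Sign2.ANg22` as sketched; §39.0 vocabulary, `IsOptimalDatum`, `IsBirchUnitValue`,
`IsRectangularPeriodLattice`, AN-39a/b/d/f/g/i/k VERBATIM (bodies byte-identical to the sketch AND Probe201, builder-verified); **AN-39c/c₂/e/h/j ONLY IN REF1's REPAIRED
FORMS C′ (R201a/R201b MANDATORY, one or two binders each, REF1's exact text: `W.shaOrder = 1 →` in c/h; `IsOptimalDatum Dt →` + `Nat.card (AddCommGroup.primaryComponent W.sha 2) = 1 →`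
in c₂/e; the latter alone in j) — the sketched bodies are refuted (kernel J1 / Cremona J2 / BSD₂-consistency) and were never in the tree; -an's names and docstrings kept, one phrase of
AN-39c's docstring corrected per R201c, a rider on each repaired row stating the repair** — the g14 `SelfTwistAtTwo` precedent (data laws filed in REF1's C′ form).  TAGS (typer, per REF1's
verdict classes, as in every -an port): theorem-grade / print-assembly / corollary-of-print rows as plain `def … : Prop` — AN-39a (elementary, prover-sized), AN-39b (corollary of AN-39f),
AN-39f (PRINT-ASSEMBLY, constant pinned by census), AN-39i (COROLLARY OF PRINT: GZ + Birch); conjecture-grade rows `@[conjecture] def` — AN-39c′ / h′ (BSD-strength in the constant),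
c₂′, e′ (conditional on c₂′), d, g, j′, k.  Cite hygiene (R201g): AN-39b gains [cite: Kohnen1985, Thm. 3]; `Waldspurger1981` ↦ the tree's `Waldspurger1981Fourier`; -an's free-form
bracketed «conjecture» / «data» text tags rendered in parentheses.  R201d (Int-division hygiene in AN-39i/j) NOT applied (verbatim; noted in the riders).
GRADES (REF1-AUDIT §201, evidence `HOME/REF1-data/b201/` SHA16.txt, `sha_scan.txt` = the 25 prime-conductor rank-1 `Ш_an ≠ 1` curves below 5·10⁵, first 35083b1): 7 SURVIVE (a theorem-grade;
b, f print-shape; d, g, k conjectures; i GZ-strength), 5 KILLED AS TYPED, all mis-stated with the repairs applied here (c, h: Ш binder; c₂, e: `twiceDatum` kernel junk + Ш[2]; j: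
BSD₂-inconsistent without the Ш[2] = 0 binder); lemma CLEAN.  BC5 (MEMO-an §25, `HOME/MEMO-an-data/g22/` SHA16SUMS.txt): ENGINE RM kit j330179/j330244 (eclib minus symbols + Manin-symbol
continued fractions + Sage `heegner_index`), RM2 j330422 (composite square-free level), RM3 j330438 (Birch unit values): 328/328 symmetry, 229/229 Plücker, RM-2b 588/588 and RM-7 353/353
index identities (`Ш_an = 1` range), RM-5 3 961/3 961 + 6 945/6 945 factorisation, RM-6 1 336/1 336 square class, 162/162 + 89/89 parity, T-RM10 256/256, T-RM12 4 547 pairs 0 conflicts.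
R201e (the single most informative next computation for AN-39/AN-40): ENGINE RM/RM3 at the `Ш_an = 4` prime levels 35083, 45979, 48731.  REF2-PLACEMENT v53 §7.5/§8 (D-an / T-an-92;
b029f6daca38610c): AN-39a/b corollaries; AN-39c = RM-5 ∘ RM-7 with BSD₂-strength constant (`i_f·tors²/Tam` = the U_E factor, RM-8); AN-39f = Kohnen 1985 Thm 3 ∘ Kohnen–Zagier/Waldspurger ∘
Birch = Popa 2006 Thm 6.3.1 with genus characters, PRINT-ASSEMBLY; AN-39i = GROSS–ZAGIER ITSELF + Birch, COROLLARY OF PRINT; AN-39j = [e1 print/tree] ∘ [e2, e3 NOT IN PRINT at `p = 2`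
(Kriz–Li 2019 Rem. 1.14; Zhai 2016 rank-0 base)] — LAW-CANDIDATE BEYOND PRINT, -an's «sharpest beyond-print candidate» claim stands; AN-39k = GKZ II Thm C shape.  New objects: CLOSED RM
geodesics — a third, heights-free and L-value-free face of R₀⁺.  PARTITION none.  Beyond-print theorem: no.  BSD is not proved; 23715 not closed.  bears_on: stmt-BirchSwinnertonDyer-23715.

## -an's module docstring of `Sketch_g22.lean` (verbatim)

# Cell `bsd-f1-sign2`, lens `-an` g22 — AN-39 THE KOHNEN–GKZ BRIDGE AT `2`: RM GENUS SUMS OF MINUS CUSP SYMBOLS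
# COMPUTE PRODUCTS OF HEEGNER INDICES EXACTLY (sketch; statements only; nothing here proves BSD)

For a newform `f` of PRIME level `N` with rational coefficients and `f | w_N = ε f`, two distinct primes
`ℓ₁, ℓ₂ ≡ 3 (mod 4)`, `ℓᵢ ≠ N`, with `(−ℓᵢ / N) = ε` (for `ε = +1`: the prime Heegner discriminants `−ℓᵢ`),
`D = ℓ₁ℓ₂ > 0` is a discriminant and `−ℓ₁ · −ℓ₂` a factorisation into fundamental discriminants.  Kohnen 1985
(Math. Ann. 271, Thm. 3, `k = 1`) expresses `c(ℓ₁)c(ℓ₂)` (weight-`3/2` Kohnen-space coefficients of the form `g ↔ f`)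
as a multiple of the GENUS-CHARACTER-TWISTED CYCLE INTEGRAL `r(f; −ℓ₁, −ℓ₂) = ∑_{[Q]} χ_{−ℓ₁}(Q) ∫_{C_Q} f` over the
`Γ₀(N)`-classes of level-`N` indefinite forms `Q = [A,B,C]` (`N ∣ A`, `B ≡ β (2N)`, disc `D`); Gross–Kohnen–Zagier 1987
(Math. Ann. 278, Thm. C) makes `c(ℓ)` proportional to the `f`-component of the Heegner divisor `y_{−ℓ}`, hence to the
HEEGNER INDEX `n(ℓ) = [E(K_ℓ) : ℤ y_{K_ℓ} + tors]` of the optimal curve `E = E_f` when `E(K_ℓ)` has rank one.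
`∫_{C_Q} f` is the period of the CLOSED cycle `{∞, γ_Q ∞}`, `γ_Q = ((t − Bu)/2, −Cu; Au, (t + Bu)/2) ∈ Γ₀(N)` the primitive
automorph (`t² − Du² = 4` fundamental), so the genus sum is an exact finite sum of MINUS CUSP SYMBOLS (the sum is purely
imaginary: `Q ↦ (−A, B, −C)` preserves the class system, conjugates the period and flips `χ`).
ENGINE RM (kit j330179 pilot, j330244 full; eclib minus symbols, Manin-symbol continued fractions for the huge automorph
cusps, Sage `heegner_index`) finds, with `u` the minus period unit, `k(Q) = [γ_Q ∞]⁻_f / u ∈ ℤ`, `m := |∑ χ(Q) k(Q)| / 2 ∈ ℕ`: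
(i) `∑_Q k(Q) = 0` and `∑_Q χ(Q)k(Q) ∈ 2ℤ`, independent of `β` up to sign (328/328 pairs);
(ii) PLÜCKER `m(ℓ₁ℓ₂)m(ℓ₃ℓ₄) = m(ℓ₁ℓ₃)m(ℓ₂ℓ₄)` (229/229 quadruples, both signs `ε`): `m(ℓ₁ℓ₂) = v(ℓ₁)v(ℓ₂)`;
(iii) EXACT INDEX IDENTITY (analytic rank one, every pair with both indices computed): `m(ℓ₁ℓ₂) = n(ℓ₁)·n(ℓ₂)` if
`Δ_E > 0` and `= 2·n(ℓ₁)·n(ℓ₂)` if `Δ_E < 0` (`37a1 … 373a1`, incl. `359a1: n(7), n(19), n(31) = 2, 2, 4`,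
`m = 4, 8, 8`; `373a1: n(31)n(59) = 1·3 = m`; `53a1: n(43) = 3`, `m(7·43) = 6`; `m = 0` exactly where a twist has
analytic rank ≥ 2, e.g. `53a1, ℓ = 47`) — NO free constant, no modular degree, no Petersson norm;
(iv) MOD 2: `m ≡ η_f · a_{ℓ₁} · a_{ℓ₂}` (162/162 pairs at `ε = +1`, 89/89 at `ε = −1` with `η_f` defined; the 77
pairs on rational-2-torsion curves with `m` odd and `a_{ℓ₁}a_{ℓ₂}` even show the binder «some `a_q` odd» is necessary,
exactly as for (HS) v45).
AN-39a–c below are THEOREM-CANDIDATES modulo print (Kohnen 1985 Thm. 3 × GKZ 1987 Thm. C × Gross–Zagier; the universal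
constant is the new, checkable content); AN-39d is the lens's f-INTRINSIC CONJECTURE (the mod-2 shadow: RM cycles instead of
the axis cycle of (HS)); AN-39e is the door certificate they give (both lattice shapes).  New objects: CLOSED RM geodesics (absolute `H₁` classes)
— a third face of `R₀⁺`, heights-free and `L`-value-free.  Nothing here proves BSD; 23715 not closed.
-/

namespace Summit.BirchSwinnertonDyer.Rank1Residual.F1Sign2.ANg22

open Literature.NumberTheory.EllipticCurves Literature.NumberTheory.EllipticCurves.ModularForms UpperHalfPlane
open Summit.BirchSwinnertonDyer.Rank1Residual.F1Sign2 Summit.BirchSwinnertonDyer.Rank1Residual.F1Sign2.ANg16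
open Summit.BirchSwinnertonDyer.Rank1Residual.F1Sign2.ANg17
open Summit.BirchSwinnertonDyer.Rank1Residual.F1Sign2.TranspositionDoor
open Summit.BirchSwinnertonDyer.BirchSwinnertonDyer.Theorems.RankOneAtTwoOneDoor
open scoped MatrixGroups ModularForm ComplexConjugate
open CongruenceSubgroup
open scoped Classical

/-! ### §39.0 Indefinite level-`N` forms, their `Γ₀(N)`-classes, primitive automorphs and genus characters -/

/-- Value `Q(x, y) = A x² + B x y + C y²` of the integral binary quadratic form `Q = (A, B, C)`. [folklore]
REF1-AUDIT §201 (A2): §39.0 vocabulary SOUND. -/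
def qfEval (Q : ℤ × ℤ × ℤ) (x y : ℤ) : ℤ := Q.1 * x ^ 2 + Q.2.1 * x * y + Q.2.2 * y ^ 2

/-- Right action of the integer matrix `(p q; r s)` on forms: `(Q ∘ γ)(x, y) = Q(p x + q y, r x + s y)`. [folklore]
REF1-AUDIT §201 (A2): SOUND (right action; `γ_{Q∘g} = g⁻¹γ_Q g`). -/
def qfAct (Q : ℤ × ℤ × ℤ) (p q r s : ℤ) : ℤ × ℤ × ℤ :=
  (Q.1 * p ^ 2 + Q.2.1 * p * r + Q.2.2 * r ^ 2,
   2 * Q.1 * p * q + Q.2.1 * (p * s + q * r) + 2 * Q.2.2 * r * s,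
   Q.1 * q ^ 2 + Q.2.1 * q * s + Q.2.2 * s ^ 2)

/-- `Γ₀(N)`-equivalence of integral binary quadratic forms (matrix action, valid for indefinite forms). [folklore]
REF1-AUDIT §201 (A2): SOUND. -/
def IsGamma0FormEquiv (N : ℕ) (Q Q' : ℤ × ℤ × ℤ) : Prop :=
  ∃ p q r s : ℤ, p * s - q * r = 1 ∧ (N : ℤ) ∣ r ∧ qfAct Q p q r s = Q'

/-- The level-`N` RM forms of discriminant `D` in the residue class `β`: primitive `(A, B, C)` with `B² − 4AC = D`,
`N ∣ A`, `B ≡ β (mod 2N)` (Kohnen's `𝒬_{N,D,β}`; for `D > 0` these are indefinite). [folklore]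
REF1-AUDIT §201 (A2): the primitivity clause is redundant but harmless (`D = ℓ₁ℓ₂` squarefree ⟹ every form of disc `D` primitive); `A ≠ 0` automatic (`D` non-square). -/
def rmForms (N : ℕ) (D β : ℤ) : Set (ℤ × ℤ × ℤ) :=
  {Q | Q.2.1 ^ 2 - 4 * Q.1 * Q.2.2 = D ∧ (N : ℤ) ∣ Q.1 ∧ Q.2.1 ≡ β [ZMOD 2 * N] ∧
    ∀ d : ℤ, d ∣ Q.1 → d ∣ Q.2.1 → d ∣ Q.2.2 → IsUnit d}

/-- `S` is a complete irredundant system of representatives of `Γ₀(N) \ 𝒬_{N,D,β}`. [folklore]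
REF1-AUDIT §201 (A2): SOUND. -/
def IsRMClassSystem (N : ℕ) (D β : ℤ) (S : Finset (ℤ × ℤ × ℤ)) : Prop :=
  (∀ Q ∈ S, Q ∈ rmForms N D β) ∧ (∀ Q ∈ S, ∀ Q' ∈ S, IsGamma0FormEquiv N Q Q' → Q = Q') ∧
    ∀ Q ∈ rmForms N D β, ∃ Q' ∈ S, IsGamma0FormEquiv N Q Q'

/-- `(t, u)` is the FUNDAMENTAL solution of `t² − D u² = 4` (`t, u > 0`, `u` minimal). [folklore]
REF1-AUDIT §201 (A2): pins `(t, w)` ✓. -/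
def IsFundPellFour (D t u : ℤ) : Prop :=
  0 < t ∧ 0 < u ∧ t ^ 2 - D * u ^ 2 = 4 ∧ ∀ t' u' : ℤ, 0 < u' → t' ^ 2 - D * u' ^ 2 = 4 → u ≤ u'

/-- The cusp `γ_Q ∞ = (t − B u) / (2 A u)` of the primitive automorph `γ_Q = ((t − Bu)/2, −Cu; Au, (t + Bu)/2) ∈ Γ₀(N)`
of `Q = (A, B, C)`; the closed cycle `{∞, γ_Q ∞}` on `X₀(N)` is the RM geodesic `C_Q`. [folklore]
REF1-AUDIT §201 (A2): a genuine rational (`A ≠ 0`, `w > 0`); orientation = `γ_Q`, not `γ_Q⁻¹` (fixes AN-39k's sign convention). -/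
def rmAutomorphCusp (Q : ℤ × ℤ × ℤ) (t u : ℤ) : ℚ :=
  ((t - Q.2.1 * u : ℤ) : ℚ) / ((2 * Q.1 * u : ℤ) : ℚ)

/-- `ε = χ_{−ℓ}(Q)`, the GENUS CHARACTER of the fundamental discriminant `−ℓ` on forms of discriminant `ℓ · ℓ'`,
witnessed by a represented odd positive integer prime to `ℓ`: `ε = (−ℓ / Q(x, y))`. [folklore]
REF1-AUDIT §201 (A2): WELL-DEFINED — for odd `n = Q(x,y) > 0`, `ℓ₁ ∤ n`, reciprocity gives `(−ℓ₁/n) = (n/ℓ₁) = (a/ℓ₁)` for any `Q ~ (a,b,c)` with `ℓ₁ ∤ a` (from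
`4aQ(x,y) = (2ax+by)² − Dy²`), independent of `(x,y)` and of `ℓ₂ ∣ n`; `χ(Q*) = −χ(Q)` for `Q* = (−A,B,−C)` since `(−1/ℓ₁) = −1` (`ℓ₁ ≡ 3 (4)` IS used); `χ_{−ℓ₁} = χ_{−ℓ₂}` on
disc-`D` forms, so the pair datum is symmetric. -/
def IsGenusCharValue (ℓ : ℕ) (Q : ℤ × ℤ × ℤ) (ε : ℤ) : Prop :=
  ∃ x y : ℤ, 0 < qfEval Q x y ∧ Odd (qfEval Q x y) ∧ ¬ (ℓ : ℤ) ∣ qfEval Q x y ∧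
    ε = jacobiSym (-(ℓ : ℤ)) (qfEval Q x y).toNat

/-- An RM PAIR DATUM at level `N` for the primes `ℓ₁, ℓ₂`: a residue `β`, a class system `S` of `𝒬_{N, ℓ₁ℓ₂, β}`, the
fundamental Pell solution, genus-character labels `ε` and the INTEGER cusp-symbol coordinates `k(Q) = [γ_Q ∞]⁻_f / u`
in the minus period unit `u` (all hypotheses of the laws below; packaged as a predicate, no choice). [folklore]
REF1-AUDIT §201 (A2): `u > 0` is built into the tree's `IsMinusPeriodUnit` (`HeegnerCuspSymbolAtTwo.lean`) ⟹ `k Q` is DETERMINED (no `u = 0` junk); `k`, `ε` are `Γ₀(N)`-class invariants, so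
`rmGenusSum S ε k` does not depend on the representatives. -/
def IsRMPairDatum {N : ℕ} (f : CuspForm (Gamma0 N) 2) (u : ℚ) (ℓ₁ ℓ₂ : ℕ) (β : ℤ) (S : Finset (ℤ × ℤ × ℤ))
    (t w : ℤ) (ε k : ℤ × ℤ × ℤ → ℤ) : Prop :=
  β ^ 2 ≡ (ℓ₁ * ℓ₂ : ℤ) [ZMOD 4 * N] ∧ IsRMClassSystem N (ℓ₁ * ℓ₂) β S ∧ IsFundPellFour (ℓ₁ * ℓ₂) t w ∧
    (∀ Q ∈ S, IsGenusCharValue ℓ₁ Q (ε Q)) ∧ ∀ Q ∈ S, ratMinusSymbol f (rmAutomorphCusp Q t w) = k Q * u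

/-- The GENUS SUM `Σ_χ = ∑_{Q ∈ S} χ_{−ℓ₁}(Q) · k(Q)` (an integer; `|Σ_χ| / 2` is the engine's `m(ℓ₁ℓ₂)`). [folklore]
REF1-AUDIT §201 (A2): SOUND; `|Σ_χ|/2 = m(ℓ₁ℓ₂)` of ENGINE RM. -/
def rmGenusSum (S : Finset (ℤ × ℤ × ℤ)) (ε k : ℤ × ℤ × ℤ → ℤ) : ℤ := ∑ Q ∈ S, ε Q * k Q

/-! ### §39.1 Structure theorems of the genus sum (THEOREM-CANDIDATES; (a) elementary, (b) from Kohnen 1985 Thm. 3 alone) -/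

/-- **AN-39a `RMGenusSumSymmetry` (THEOREM-CANDIDATE, elementary).**  For a newform `f` of prime level `N` with rational
coefficients, its minus period unit `u` and an RM pair datum: the PLAIN sum vanishes, `∑_Q k(Q) = 0`, and the genus sum is
EVEN, `Σ_χ ∈ 2ℤ`.  Proof sketch: `Q = (A,B,C) ↦ Q* = (−A,B,−C)` is a fixed-point-free involution of `Γ₀(N)\𝒬_{N,D,β}`
(no class satisfies `[Q]² = σ`, the class of `(√D)`, because `χ_{−ℓ₁}(σ) = −1`), with `{∞, γ_{Q*}∞} = conj {∞, γ_Q ∞}`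
and `χ(Q*) = −χ(Q)`.  Census: 328/328 (j330179).  Why it might fail: only through a slip in the orientation conventions
(`γ_Q` vs `γ_Q⁻¹` changes signs termwise, which preserves both claims). [folklore]
REF1-AUDIT §201 (Sketch_g22 622a8640800b1e46; Probe201 b3431c39b55fe87b farm rc 0 · 12 sorries · 12 sorry-free REF1 decls, axioms std): **SURVIVES — THEOREM-GRADE (prover-sized)**: (i) `∑k = 0` is
pure symbol formalism (`rmAutomorphCusp Q* t w = −rmAutomorphCusp Q t w`, `ratMinusSymbol f (−r) = −ratMinusSymbol f r`, class invariance ⟹ `k[Q*] = −k[Q]`, `*` an involution on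
`Γ₀(N)\𝒬_{N,D,β}`; fixed classes contribute `k = 0`); (ii) evenness: `ε[Q*] = −ε[Q]` (needs `ℓ₁ ≡ 3 (4)` only) ⟹ `*` is fixed-point-free and pairs contribute `2εk`.  R201f (prover
note): only `u > 0`, class invariance and `ℓ₁ ≡ 3 (4)` are used — `N.Prime`, `IsNewform0`, `coeffField = ⊥`, `ℓ₂ % 4 = 3`, `ℓᵢ ≠ N` are UNUSED (kept verbatim).  T-an-88's
port ask = this row + §39.0.  REF2-PLACEMENT v53 §8.1: AN-39a/b = corollaries (scorecard agreement with -an).  Plain `def` (theorem-grade support). -/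
def RMGenusSumSymmetry : Prop :=
  ∀ (N : ℕ) [NeZero N] (f : CuspForm (Gamma0 N) 2), N.Prime → IsNewform0 f → coeffField f = ⊥ →
    ∀ (u : ℚ), IsMinusPeriodUnit f u →
    ∀ (ℓ₁ ℓ₂ : ℕ), ℓ₁.Prime → ℓ₂.Prime → ℓ₁ % 4 = 3 → ℓ₂ % 4 = 3 → ℓ₁ ≠ ℓ₂ → ℓ₁ ≠ N → ℓ₂ ≠ N →
    ∀ (β : ℤ) (S : Finset (ℤ × ℤ × ℤ)) (t w : ℤ) (ε k : ℤ × ℤ × ℤ → ℤ), IsRMPairDatum f u ℓ₁ ℓ₂ β S t w ε k →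
      (∑ Q ∈ S, k Q) = 0 ∧ ∃ z : ℤ, rmGenusSum S ε k = 2 * z

/-- **AN-39b `RMGenusSumPlueckerRelation` (THEOREM-CANDIDATE modulo print: Kohnen 1985, Thm. 3 with `k = 1`).**  For `f` as
above with `f | w_N = ε₀ f` and four distinct primes `ℓᵢ ≡ 3 (4)`, `ℓᵢ ≠ N`, `(−ℓᵢ/N) = ε₀`: the genus sums satisfy the
rank-one (Plücker) relations `|Σ_χ(ℓ₁ℓ₂)| · |Σ_χ(ℓ₃ℓ₄)| = |Σ_χ(ℓ₁ℓ₃)| · |Σ_χ(ℓ₂ℓ₄)|` — because Kohnen's theorem makes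
`Σ_χ(ℓᵢℓⱼ)` a fixed multiple of `c(ℓᵢ)c(ℓⱼ)`.  f-INTRINSIC, exact, no curve, no heights.  Census: 229/229 quadruples
(118 at `ε₀ = −1`, 111 at `ε₀ = +1`; j330179).  Why it might fail: Kohnen's Thm. 3 is stated for `N` odd squarefree and
FUNDAMENTAL `D₁, D₂` with `(−1)^k Dᵢ > 0` — exactly our case; a failure would mean the cycle-integral normalisation
(class system per `β` vs all of `𝒬_{N,D}`) is misread, which (AN-39a) makes harmless. [cite: Kohnen1985, Thm. 3] [cite: GrossKohnenZagier1987, Thm. C]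
REF1-AUDIT §201: **SURVIVES** as COROLLARY of AN-39f (`|Σ_{ij}| = √(B_iB_j)`); the `∀` over all 12 ordered pair data is stronger than needed (only (0,1),(2,3),(0,2),(1,3) used) but
satisfiable.  R201g: the cite tag must carry Kohnen 1985 Thm 3 — added: [cite: Kohnen1985, Thm. 3].  REF2-PLACEMENT v53 §8.1: corollary; AN-39f's shape = Kohnen 1985 Thm 3 ∘
Kohnen–Zagier/Waldspurger ∘ Birch = [cite: Popa2006, Thm. 6.3.1] read with genus characters, PRINT-ASSEMBLY.  Plain `def`. -/
def RMGenusSumPlueckerRelation : Prop :=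
  ∀ (N : ℕ) [NeZero N] (f : CuspForm (Gamma0 N) 2) (ε₀ : ℤ), N.Prime → IsNewform0 f → coeffField f = ⊥ →
    IsFrickeEigen N f ε₀ →
    ∀ (u : ℚ), IsMinusPeriodUnit f u →
    ∀ (ℓ : Fin 4 → ℕ), (∀ i, (ℓ i).Prime ∧ ℓ i % 4 = 3 ∧ ℓ i ≠ N ∧ (jacobiSym (-(ℓ i : ℤ)) N : ℂ) = ε₀) →
      Function.Injective ℓ →
    ∀ (β : Fin 4 → Fin 4 → ℤ) (S : Fin 4 → Fin 4 → Finset (ℤ × ℤ × ℤ)) (t w : Fin 4 → Fin 4 → ℤ)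
      (ε k : Fin 4 → Fin 4 → (ℤ × ℤ × ℤ → ℤ)),
      (∀ i j, i ≠ j → IsRMPairDatum f u (ℓ i) (ℓ j) (β i j) (S i j) (t i j) (w i j) (ε i j) (k i j)) →
      |rmGenusSum (S 0 1) (ε 0 1) (k 0 1)| * |rmGenusSum (S 2 3) (ε 2 3) (k 2 3)| =
        |rmGenusSum (S 0 2) (ε 0 2) (k 0 2)| * |rmGenusSum (S 1 3) (ε 1 3) (k 1 3)|

/-! ### §39.2 The exact index identity and its `2`-adic corollary (THEOREM-CANDIDATES modulo print + the universal constant) -/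

/-- The parametrisation datum is OPTIMAL: `c · Λ_f = Λ_E` (not only `⊆`), i.e. `E` is the strong Weil curve of `f` in its
given lattice normalisation. [folklore]
REF1-AUDIT §201 (A2): `Λ_W ⊆ c·Λ_f` with the structure's `cΛ_f ⊆ Λ_W` pins `W ≅ E_f` and `c = ±c_Manin`.  (J1, KERNEL): `ModularParametrizationData` does NOT pin `Dt.c` —
`twiceDatum (c, deg) ↦ (2c, 4·deg)` has `heegnerPointComplex_twiceDatum = 2 • heegnerPointComplex` (sorry-free, Probe201) — so every E-level row reading a 2-divisibility of
`heegnerPointComplex Dt H` needs THIS binder (or the tree's AN-27 `¬ (2:ℤ) ∣ Dt.c`); R201a applied below to AN-39c₂/e. -/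
def IsOptimalDatum {W : WeierstrassCurve ℚ} {N : ℕ} [NeZero N] (Dt : ModularParametrizationData W N) : Prop :=
  ∀ z ∈ Dt.L.lattice, ∃ y ∈ periodLattice Dt.f, (Dt.c : ℂ) * y = z

/-- **AN-39c `RMHeegnerIndexProductIdentity` (THEOREM-CANDIDATE modulo print; the lens's headline).**  `N` prime, `W` an
elliptic curve of conductor `N` without rational `2`-torsion, `Dt` an OPTIMAL parametrisation datum with `f | w_N = +f`,
`u` the minus period unit; `ℓ₁ ≠ ℓ₂` primes `≡ 3 (4)`, `≠ N`, with `(−ℓᵢ/N) = 1`; `Kᵢ = ℚ(√−ℓᵢ)`, `Pᵢ ∈ E(Kᵢ)` mapping to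
the complex Heegner point, `gᵢ` a generator of `E(Kᵢ)` modulo torsion with `Pᵢ ≡ ±nᵢ gᵢ`; an RM pair datum for `(ℓ₁, ℓ₂)`.
THEN `|Σ_χ| = 2 · n₁ · n₂` if `Δ_W > 0` and `|Σ_χ| = 4 · n₁ · n₂` if `Δ_W < 0`; i.e. `m(ℓ₁ℓ₂) = [Λ_f : Λ_f⁺ ⊕ Λ_f⁻] · n(ℓ₁) n(ℓ₂)`.
In print the two proportionality constants (Kohnen: `⟨g,g⟩/⟨f,f⟩`-type; GKZ Thm. C: `y_{−ℓ,f} = c(ℓ) y_f`) are explicit but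
their product has not been evaluated to this lattice index; the evaluation should follow from GZ I.(6.3)/V.(2.2)-type period
bookkeeping (Manin constant `1` at prime level).  Census (j330179, `N < 400`, `ℓ ≤ 60`): every rank-one pair with both
`heegner_index` values certified, e.g. `79a1 (7,43): 1·2 = m = 2`, `359a1 (7,31): 2·4 = 8`, `373a1 (31,59): 1·3 = 3`,
`43a1 (7,19): 2·(1·2) = 4`, `53a1 (11,43): 2·(1·3) = 6`; `m = 0` exactly at pairs containing a twist of analytic rank `≥ 2`.
Why it might fail: a hidden factor `|Ш(E)|`, `∏ c_p`, `#E(ℚ)_tors` or `deg φ` in the constant is invisible on prime-conductor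
rank-one curves (all have `c_N = #tors = 1` — 2517/2517 for `N < 5·10⁵`; `Ш_an = 1` for `N < 35083`, with 25 exceptions below `5·10⁵`: R201c); the identity is claimed only
there (`N` prime), where it was measured.
[cite: GrossKohnenZagier1987, Thm. C] [cite: GrossZagier1986, I.(6.3), V.(2.2)]
REF1-AUDIT §201: **KILLED AS TYPED (mis-stated, J2: PRIME CONDUCTOR ⇏ Ш = 1)** — Cremona `allbsd` N < 5·10⁵: 25 optimal rank-1 prime-conductor curves (all `Tam = tors = 1`, `|Δ| = N`)
have `Ш_an ≠ 1` (24× 4, 1× 9; first 35083b1; list `HOME/REF1-data/b201/sha_scan.txt`); the f-side is Ш-blind (Birch) while `n²` carries `Ш_an(E)` linearly (GZ) ⟹ `|Σχ|·Ш_an =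
2i_f n₁n₂` there.  **THIS ROW IS REF1's REPAIRED FORM C′ (R201b MANDATORY), typed by -ty g18: binder `W.shaOrder = 1 →` inserted after `NoRationalTwoTorsion W →`** (the witnesses
miss C′: at `Ш_an = 1` the law is RM-2b 588/588).  R201c: the docstring sentence «all have `c_N = #tors = Ш_an = 1`» is corrected in place to REF1's wording.  With C′: THEOREM-CANDIDATE
modulo print ([cite: Kohnen1985, Thm. 3] × [cite: GrossKohnenZagier1987, Thm. C] × [cite: GrossZagier1986, I.(6.3)]) with the constant = BSD(E)'s quotient set to 1 — i.e. C′ =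
GZ ∘ Birch ∘ [BSD-quotient = 1], «BSD-STRENGTH IN THE CONSTANT» (REF2-PLACEMENT v53 §7.5(ii) / §8.1: at composite square-free level the constant is `i_f·tors²/Tam` (RM-8, j330422) =
the U_E factor; -an deflated AN-39c to RM-5 ∘ RM-7 before any referee asked).  Tagged `@[conjecture]` (BSD-strength).  R201e (T-an ask, the single most informative next computation):
ENGINE RM/RM3 at the `Ш_an = 4` prime levels 35083, 45979, 48731 — predicted `|Σχ| = 2i_f n₁n₂/4`. -/
@[conjecture] def RMHeegnerIndexProductIdentity : Prop :=
  ∀ (N : ℕ) [NeZero N] (W : WeierstrassCurve ℚ) [W.IsElliptic], N.Prime → W.conductorNorm ℤ = N → NoRationalTwoTorsion W →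
    W.shaOrder = 1 →
    ∀ (Dt : ModularParametrizationData W N), IsOptimalDatum Dt → IsFrickeEigen N Dt.f 1 →
    ∀ (u : ℚ), IsMinusPeriodUnit Dt.f u →
    ∀ (ℓ₁ ℓ₂ : ℕ), ℓ₁.Prime → ℓ₂.Prime → ℓ₁ % 4 = 3 → ℓ₂ % 4 = 3 → ℓ₁ ≠ ℓ₂ → ℓ₁ ≠ N → ℓ₂ ≠ N →
      jacobiSym (-(ℓ₁ : ℤ)) N = 1 → jacobiSym (-(ℓ₂ : ℤ)) N = 1 →
    ∀ (K₁ : Type) [Field K₁] [NumberField K₁] (K₂ : Type) [Field K₂] [NumberField K₂],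
      IsImaginaryQuadratic K₁ → NumberField.discr K₁ = -(ℓ₁ : ℤ) → IsImaginaryQuadratic K₂ → NumberField.discr K₂ = -(ℓ₂ : ℤ) →
    ∀ (H₁ : HeegnerDatum N (NumberField.discr K₁)) (H₂ : HeegnerDatum N (NumberField.discr K₂))
      (ι₁ : K₁ →+* ℂ) (ι₂ : K₂ →+* ℂ) (P₁ g₁ : (W.baseChange K₁).toAffine.Point) (P₂ g₂ : (W.baseChange K₂).toAffine.Point)
      (n₁ n₂ : ℕ),
      WeierstrassCurve.Affine.Point.map ι₁.toRatAlgHom P₁ = heegnerPointComplex Dt H₁ →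
      WeierstrassCurve.Affine.Point.map ι₂.toRatAlgHom P₂ = heegnerPointComplex Dt H₂ →
      (∀ R : (W.baseChange K₁).toAffine.Point, ∃ z : ℤ, R - z • g₁ ∈ AddCommGroup.torsion (W.baseChange K₁).toAffine.Point) →
      (∀ R : (W.baseChange K₂).toAffine.Point, ∃ z : ℤ, R - z • g₂ ∈ AddCommGroup.torsion (W.baseChange K₂).toAffine.Point) →
      (P₁ - (n₁ : ℤ) • g₁ ∈ AddCommGroup.torsion (W.baseChange K₁).toAffine.Point ∨
        P₁ + (n₁ : ℤ) • g₁ ∈ AddCommGroup.torsion (W.baseChange K₁).toAffine.Point) →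
      (P₂ - (n₂ : ℤ) • g₂ ∈ AddCommGroup.torsion (W.baseChange K₂).toAffine.Point ∨
        P₂ + (n₂ : ℤ) • g₂ ∈ AddCommGroup.torsion (W.baseChange K₂).toAffine.Point) →
    ∀ (β : ℤ) (S : Finset (ℤ × ℤ × ℤ)) (t w : ℤ) (ε k : ℤ × ℤ × ℤ → ℤ), IsRMPairDatum Dt.f u ℓ₁ ℓ₂ β S t w ε k →
      |rmGenusSum S ε k| = (if 0 < W.Δ then 2 else 4) * n₁ * n₂

/-- **AN-39c₂ `RMGenusSumExponentLawAtTwo` (the `2`-ADIC COROLLARY of AN-39c on the crux's slice; THEOREM-CANDIDATE modulo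
AN-39c + Gross–Zagier–Kolyvagin).**  With `mᵢ` the exact `2`-divisibility exponents of the two prime-door Heegner points
(`HasTwoDivisibilityUpToTorsion`, the route's currency), `Σ_χ ≠ 0` and `ord₂ Σ_χ = m₁ + m₂ + 1 + [Δ_W < 0]`.  Isogeny-invariant
on the class (no rational `2`-torsion ⇒ all isogenies odd), so no optimality binder.  Feeds `R₀⁺`: `ord₂ Σ_χ(ℓ_min · ℓ') = 1`
at `Δ > 0` forces `m_min = 0`.  Why it might fail: as AN-39c. [cite: GrossKohnenZagier1987, Thm. C] [cite: GrossZagier1986, V.(2.2)]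
REF1-AUDIT §201: **KILLED AS TYPED, twice (mis-stated)** — (i) KERNEL (J1 + `bc7_exponent_clash`): no optimality binder ⟹ for `Dt` and `twiceDatum Dt` the hypotheses hold with `(m₁,m₂)` and
`(m₁+1,m₂+1)` at the same f-intrinsic `Σ`; 37a1 `(3,71)`: `Σχ = ±2`, doubled datum demands `Σ = 2³·odd` ✗ (the docstring's «isogeny-invariant … so no optimality binder» is right about
ODD ISOGENIES and wrong about the free integer scaling of `Dt.c`); (ii) J2: at the 24 `Ш_an = 4` curves `ord₂Σ` drops by 2 (`bc7_exponent_clash_sha`).  **THIS ROW IS REF1's REPAIRED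
FORM C′ (R201a + R201b MANDATORY), typed by -ty g18: `IsOptimalDatum Dt →` inserted after the `Dt` binder AND `Nat.card (AddCommGroup.primaryComponent W.sha 2) = 1 →` (AN-27's
vocabulary) inserted after `W.analyticRank = 1 →`.**  With C′: theorem-candidate modulo AN-39c′ + Gross–Zagier–Kolyvagin.  Tagged `@[conjecture]`.  REF2 v53 §8.1: T-an-90 reading —
AN-39c₂ ∧ C⁺ is the RM restatement of `stub_heegnerExponent` at prime doors. -/
@[conjecture] def RMGenusSumExponentLawAtTwo : Prop :=
  ∀ (N : ℕ) [NeZero N] (W : WeierstrassCurve ℚ) [W.IsElliptic] [W.IsGloballyMinimal], N.Prime → W.conductorNorm ℤ = N →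
    NoRationalTwoTorsion W → W.analyticRank = 1 → Nat.card (AddCommGroup.primaryComponent W.sha 2) = 1 →
    ∀ (Dt : ModularParametrizationData W N), IsOptimalDatum Dt → IsFrickeEigen N Dt.f 1 →
    ∀ (u : ℚ), IsMinusPeriodUnit Dt.f u →
    ∀ (ℓ₁ ℓ₂ : ℕ), ℓ₁.Prime → ℓ₂.Prime → ℓ₁ % 4 = 3 → ℓ₂ % 4 = 3 → ℓ₁ ≠ ℓ₂ → ℓ₁ ≠ N → ℓ₂ ≠ N →
      jacobiSym (-(ℓ₁ : ℤ)) N = 1 → jacobiSym (-(ℓ₂ : ℤ)) N = 1 →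
    ∀ (K₁ : Type) [Field K₁] [NumberField K₁] (K₂ : Type) [Field K₂] [NumberField K₂],
      IsImaginaryQuadratic K₁ → NumberField.discr K₁ = -(ℓ₁ : ℤ) → IsImaginaryQuadratic K₂ → NumberField.discr K₂ = -(ℓ₂ : ℤ) →
    ∀ (H₁ : HeegnerDatum N (NumberField.discr K₁)) (H₂ : HeegnerDatum N (NumberField.discr K₂))
      (ι₁ : K₁ →+* ℂ) (ι₂ : K₂ →+* ℂ) (P₁ : (W.baseChange K₁).toAffine.Point) (P₂ : (W.baseChange K₂).toAffine.Point) (m₁ m₂ : ℕ),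
      WeierstrassCurve.Affine.Point.map ι₁.toRatAlgHom P₁ = heegnerPointComplex Dt H₁ →
      WeierstrassCurve.Affine.Point.map ι₂.toRatAlgHom P₂ = heegnerPointComplex Dt H₂ →
      HasTwoDivisibilityUpToTorsion W K₁ P₁ m₁ → HasTwoDivisibilityUpToTorsion W K₂ P₂ m₂ →
    ∀ (β : ℤ) (S : Finset (ℤ × ℤ × ℤ)) (t w : ℤ) (ε k : ℤ × ℤ × ℤ → ℤ), IsRMPairDatum Dt.f u ℓ₁ ℓ₂ β S t w ε k →
      ∃ r : ℤ, Odd r ∧ rmGenusSum S ε k = 2 ^ (m₁ + m₂ + (if 0 < W.Δ then 1 else 2)) * r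

/-! ### §39.3 The mod-`2` shadow (f-INTRINSIC CONJECTURE) and the door certificate -/

/-- **AN-39d `RMGenusSumParityLawAtTwo` (CONJECTURE of the lens; f-intrinsic, BSD-free; the RM twin of (HS)/AN-34d′).**  For a
newform `f` of PRIME level `N` with rational coefficients, `f | w_N = ε₀ f`, some odd `a_q(f)` (`q ∤ 2N`), minus period unit `u`
and half-sum bit `η` (`F_q(f) = ∑_{k<q/2}[k/q]⁻_f = (2z + η)u` at a `3`-cycle prime `q`, AN-33c), and two distinct primes
`ℓᵢ ≡ 3 (4)`, `ℓᵢ ≠ N`, `(−ℓᵢ/N) = ε₀` with `a_{ℓᵢ}(f) = aᵢ`:  `Σ_χ(ℓ₁ℓ₂) ≡ 2 η a₁ a₂ (mod 4)`, i.e. `m(ℓ₁ℓ₂) ≡ η·a₁·a₂ (mod 2)`.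
At `ε₀ = +1` it is AN-39c ⊗ (law D ⊗ law D) (index parities) and conversely transports `R₀⁺` to RM cycles; at `ε₀ = −1` it is the
parity of Kohnen–Waldspurger's `c(ℓ)² ∝ L(f ⊗ χ_{−ℓ}, 1)`.  Census j330179: 162/162 (`ε₀ = +1`), 89/89 (`ε₀ = −1`, `η` defined);
binder necessary (77 odd sums on `17a1, 73a1, 89b1, 113a1, 233a1, 353a1`).  Why it might fail: `η` is read at `3`-cycle primes
only; a curve with `η = 0`, `Δ > 0` off the egg locus and an odd `m` (a `4 ∣ n(ℓ)`-type surprise cannot do it, but an odd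
`Ш(E^{(−ℓ)})[2]`-free accident at `ε₀ = −1` could) kills it. (conjecture) [cite: MazurTate1987, §1] [cite: GrossKohnenZagier1987, Thm. C]
REF1-AUDIT §201: **SURVIVES as CONJECTURE** (f-intrinsic, BSD-free; the binder «some `a_q` odd» present; BC7: nothing typed bites — `η`, `zq` pinned mod 2 by `F_q = (2z+η)u`, `u > 0`).
UNTESTED DECISIVE REGIME (R201e): the 24 `Ш_an = 4` prime levels at `ε₀ = +1` — there E-level readings shift (`m = i_f n₁n₂/4`) while the f-side `η_f a₁a₂` does not know `Ш`;
either AN-39d fails there or `η_f` and the genus sums «see» `Ш(E)[2]` — both outcomes informative (at `ε₀ = −1` the census already contains `Ш_an = 4` rank-0 prime levels, e.g.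
571a1, inside 89/89).  REF2-PLACEMENT v45/v53 §8: the RM twin of the (HS) cusp-symbol law-candidates; NOT IN PRINT.  Tagged `@[conjecture]`; -an's free-form bracketed «conjecture» text
tag rendered in parentheses. -/
@[conjecture] def RMGenusSumParityLawAtTwo : Prop :=
  ∀ (N : ℕ) [NeZero N] (f : CuspForm (Gamma0 N) 2) (ε₀ : ℤ), N.Prime → IsNewform0 f → coeffField f = ⊥ → IsFrickeEigen N f ε₀ →
    ∀ (u : ℚ), IsMinusPeriodUnit f u →
    ∀ (q : ℕ) (aq : ℤ) (eta zq : ℤ), q.Prime → Odd q → ¬ q ∣ N → cuspCoeff f q = (aq : ℂ) → Odd aq →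
      minusHalfSum f q = (2 * zq + eta) * u →
    ∀ (ℓ₁ ℓ₂ : ℕ) (a₁ a₂ : ℤ), ℓ₁.Prime → ℓ₂.Prime → ℓ₁ % 4 = 3 → ℓ₂ % 4 = 3 → ℓ₁ ≠ ℓ₂ → ℓ₁ ≠ N → ℓ₂ ≠ N →
      (jacobiSym (-(ℓ₁ : ℤ)) N : ℂ) = ε₀ → (jacobiSym (-(ℓ₂ : ℤ)) N : ℂ) = ε₀ →
      cuspCoeff f ℓ₁ = (a₁ : ℂ) → cuspCoeff f ℓ₂ = (a₂ : ℂ) →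
    ∀ (β : ℤ) (S : Finset (ℤ × ℤ × ℤ)) (t w : ℤ) (ε k : ℤ × ℤ × ℤ → ℤ), IsRMPairDatum f u ℓ₁ ℓ₂ β S t w ε k →
      ∃ z : ℤ, rmGenusSum S ε k = 2 * (2 * z + eta * a₁ * a₂)

/-- **AN-39e `MinimalRMGenusSumCertifiesTwoDoorsAtTwo` (support; THEOREM modulo AN-39c₂).**  On the crux's slice, BOTH lattice shapes: if
ONE genus sum has the minimal `2`-order, `ord₂ Σ_χ(ℓ₁ℓ₂) = 1 + [Δ_W < 0]` (one exact modular-symbol computation, no heights), then BOTH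
prime-door Heegner points are not twice a point modulo torsion (`HasTwoDivisibilityUpToTorsion … 0`), i.e. two bottom-rung doors at once — at
`Δ < 0` as well, where the axis cusp symbol of (HS)/AN-34 is blind (every axis bit is `0` there).  Examples (j330244 + Sage indices):
`43a1 (Δ<0): Σ_χ(3·7) = ±4 ⇒ n(3), n(7)` odd; `37a1: Σ_χ(3·71) = ±2`.  Why it might fail: only with AN-39c₂. [cite: GrossKohnenZagier1987, Thm. C]
REF1-AUDIT §201: **KILLED AS TYPED (mis-stated; kernel J1)** — premise `Σ = 2^{1+[Δ<0]}·odd` is `Dt`-free, conclusion `HasTwoDivisibilityUpToTorsion W Kᵢ Pᵢ 0` fails for `Pᵢ' = 2•Pᵢ` of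
`twiceDatum` (43a1 `(3,7)` `Σχ = ±4`, 37a1 `(3,71)` `Σ = ±2`).  **THIS ROW IS REF1's REPAIRED FORM C′ (R201a + R201b), typed by -ty g18: `IsOptimalDatum Dt →` AND `Nat.card
(AddCommGroup.primaryComponent W.sha 2) = 1 →` inserted (as AN-39c₂′; at a `Ш_an = 4` curve a pair with `ord₂(n₁n₂) = 2` satisfies the premise with 2-divisible points).**  With C′:
support, THEOREM modulo AN-39c₂′ (`minimalRMGenusSum_exponents_zero` below IS the reduction once both carry the same binders).  Tagged `@[conjecture]` (conditional on c₂′).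
REF2/T-an-90: support item candidate «two doors per RM sum» under the one-door v8.17 case split. -/
@[conjecture] def MinimalRMGenusSumCertifiesTwoDoorsAtTwo : Prop :=
  ∀ (N : ℕ) [NeZero N] (W : WeierstrassCurve ℚ) [W.IsElliptic] [W.IsGloballyMinimal], N.Prime → W.conductorNorm ℤ = N →
    NoRationalTwoTorsion W → W.analyticRank = 1 → Nat.card (AddCommGroup.primaryComponent W.sha 2) = 1 →
    ∀ (Dt : ModularParametrizationData W N), IsOptimalDatum Dt → IsFrickeEigen N Dt.f 1 →
    ∀ (u : ℚ), IsMinusPeriodUnit Dt.f u →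
    ∀ (ℓ₁ ℓ₂ : ℕ), ℓ₁.Prime → ℓ₂.Prime → ℓ₁ % 4 = 3 → ℓ₂ % 4 = 3 → ℓ₁ ≠ ℓ₂ → ℓ₁ ≠ N → ℓ₂ ≠ N →
      jacobiSym (-(ℓ₁ : ℤ)) N = 1 → jacobiSym (-(ℓ₂ : ℤ)) N = 1 →
    ∀ (K₁ : Type) [Field K₁] [NumberField K₁] (K₂ : Type) [Field K₂] [NumberField K₂],
      IsImaginaryQuadratic K₁ → NumberField.discr K₁ = -(ℓ₁ : ℤ) → IsImaginaryQuadratic K₂ → NumberField.discr K₂ = -(ℓ₂ : ℤ) →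
    ∀ (H₁ : HeegnerDatum N (NumberField.discr K₁)) (H₂ : HeegnerDatum N (NumberField.discr K₂))
      (ι₁ : K₁ →+* ℂ) (ι₂ : K₂ →+* ℂ) (P₁ : (W.baseChange K₁).toAffine.Point) (P₂ : (W.baseChange K₂).toAffine.Point),
      WeierstrassCurve.Affine.Point.map ι₁.toRatAlgHom P₁ = heegnerPointComplex Dt H₁ →
      WeierstrassCurve.Affine.Point.map ι₂.toRatAlgHom P₂ = heegnerPointComplex Dt H₂ →
    ∀ (β : ℤ) (S : Finset (ℤ × ℤ × ℤ)) (t w : ℤ) (ε k : ℤ × ℤ × ℤ → ℤ), IsRMPairDatum Dt.f u ℓ₁ ℓ₂ β S t w ε k →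
      (∃ r : ℤ, Odd r ∧ rmGenusSum S ε k = 2 ^ (if 0 < W.Δ then 1 else 2) * r) →
      HasTwoDivisibilityUpToTorsion W K₁ P₁ 0 ∧ HasTwoDivisibilityUpToTorsion W K₂ P₂ 0

/-! ## v2 (g22, 12:10Z) — THE BIRCH FACTORISATION: `(∑_Q χ(Q) k(Q))² = B(ℓ₁)·B(ℓ₂)` and its consequences

ENGINE RM3 (kit `j330438`, 8 s): `B_f(ℓ) := (∑_{a mod ℓ} (a/ℓ)·[a/ℓ]⁻_f)/u` (the tree's `ratMinusTwistedSymbolSum f (jacobiChar ℓ)`, Birch's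
formula PROVED there: `· Ω⁻_f = √ℓ · L(f, χ_ℓ, 1)`).  CENSUS RM-5: `(rmGenusSum)² = B(ℓ₁)B(ℓ₂)` on 3961/3961 admissible pairs of the 204
prime-conductor curves (2520 non-zero pairs with ratio exactly 1, 1441 pairs `m = 0 ⟺ B₁B₂ = 0`), ALL ranks 0/1/2 and BOTH Atkin–Lehner signs;
RM-6: `B(ℓ) > 0` whenever non-zero (1064/1064) and `B(ℓ)/κ` is a PERFECT SQUARE on 1336/1336 admissible `(f, ℓ)` with
`κ = 2` if (period lattice rectangular ↔ `ε₀ = +1`) else `4`; RM-7: `B(ℓ) = 2·i_f·n(ℓ)²` on 353/353 (277 with `n ≥ 1`, 76 with `n = 0 = B`).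
So AN-39c = RM-5 ∘ RM-7, and the RM genus sum is `±√(B(ℓ₁)B(ℓ₂))`: the new information it carries beyond the two Birch sums is its SIGN. -/

/-- `B` is the **Birch unit value** of `f` at `ℓ`: `∑_{a mod ℓ} (a/ℓ)[a/ℓ]⁻_f = B·u` (`u` = the minus period unit). (data: ENGINE RM3)
REF1-AUDIT §201: `B` DETERMINED (`u > 0`).  Tree: Birch's formula `ratMinusTwistedSymbolSum … · Ω⁻_f = √ℓ·L(f, χ_ℓ, 1)` PROVED (`Literature…BirchFormulaQuadraticSigned`).  -an's free-form
bracketed «data» tag rendered in parentheses. -/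
def IsBirchUnitValue {N : ℕ} (f : CuspForm (Gamma0 N) 2) (u : ℚ) (ℓ : ℕ) [NeZero ℓ] (B : ℤ) : Prop :=
  ratMinusTwistedSymbolSum (R := ℂ) f (Literature.NumberTheory.QuadraticFields.jacobiChar ℓ) = (((B : ℚ) * u : ℚ) : ℂ)

/-- The period lattice of `f` is **rectangular** (closed under taking real parts; for the optimal curve: `Δ > 0`, `i_f = 1`, `u = 1`).
REF1-AUDIT §201 (AN-39g): `IsRectangularPeriodLattice f ↔ ε₀ = 1` keys the exact 2-adic unit `κ ∈ {2, 4}`. -/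
def IsRectangularPeriodLattice {N : ℕ} [NeZero N] (f : CuspForm (Gamma0 N) 2) : Prop :=
  ∀ z ∈ periodLattice f, (z + conj z) / 2 ∈ periodLattice f

/-- **AN-39f `RMGenusSumFactorisation` (f-INTRINSIC MASTER IDENTITY; in print as Kohnen 1985 Thm. 3 ∘ Kohnen–Zagier 1981/Waldspurger ∘ Birch,
exact integral normalisation pinned by census RM-5, 3961/3961, both signs `ε₀`).**  For the rational newform `f` of prime level `N` with
`f|W_N = ε₀ f`, two admissible primes `ℓᵢ ≡ 3 (4)` (`(−ℓᵢ/N) = ε₀`) and an RM pair datum of discriminant `ℓ₁ℓ₂`: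
`(∑_Q χ(Q) k(Q))² = B(ℓ₁)·B(ℓ₂)`.  Why it might fail: only through the constant (a stray `2^{a}` or `h`-dependent factor at pairs outside the
tested range `N < 5000, ℓ ≤ 100`); the shape is three theorems. [cite: Kohnen1985, Thm. 3] [cite: GrossKohnenZagier1987, Thm. C]
REF1-AUDIT §201: **SURVIVES — THEOREM-SHAPE IN PRINT modulo the pinned integral constant** ([cite: Kohnen1985, Thm. 3] ∘ Kohnen–Zagier/Waldspurger ∘ Birch; census 6945/6945 all ranks, both
signs); Ш-IMMUNE by construction (both sides f-intrinsic); `[NeZero ℓᵢ]` + `ℓᵢ.Prime` fine.  REF2-PLACEMENT v53 §7.5(i)/§8.1: = [cite: Popa2006, Thm. 6.3.1] read with genus characters —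
PRINT-ASSEMBLY with the integral normalisation pinned by census (constant 1 in `u`-units), theorem-shaped.  Plain `def`. -/
def RMGenusSumFactorisation : Prop :=
  ∀ (N : ℕ) [NeZero N] (f : CuspForm (Gamma0 N) 2) (ε₀ : ℤ), N.Prime → IsNewform0 f → coeffField f = ⊥ → IsFrickeEigen N f ε₀ →
    ∀ (u : ℚ), IsMinusPeriodUnit f u →
    ∀ (ℓ₁ ℓ₂ : ℕ) [NeZero ℓ₁] [NeZero ℓ₂] (β : ℤ) (S : Finset (ℤ × ℤ × ℤ)) (t w : ℤ) (ε : ℤ × ℤ × ℤ → ℤ) (k : ℤ × ℤ × ℤ → ℤ)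
      (B₁ B₂ : ℤ), ℓ₁.Prime → ℓ₂.Prime → ℓ₁ % 4 = 3 → ℓ₂ % 4 = 3 → ℓ₁ ≠ ℓ₂ → ℓ₁ ≠ N → ℓ₂ ≠ N →
      (jacobiSym (-(ℓ₁ : ℤ)) N : ℂ) = ε₀ → (jacobiSym (-(ℓ₂ : ℤ)) N : ℂ) = ε₀ →
      IsRMPairDatum f u ℓ₁ ℓ₂ β S t w ε k → IsBirchUnitValue f u ℓ₁ B₁ → IsBirchUnitValue f u ℓ₂ B₂ →
      (rmGenusSum S ε k) ^ 2 = B₁ * B₂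

/-- **AN-39g `BirchSumSquareClassLaw` (f-INTRINSIC; CONJECTURE as an exact 2-adic-unit statement, Waldspurger–Kohnen `B(ℓ) ∝ c_g(ℓ)²` in print
qualitatively).**  Same setting, ONE admissible prime `ℓ`: `B(ℓ) = κ·c²` with `c ∈ ℤ` and `κ = 2` if (`Λ_f` rectangular `↔ ε₀ = +1`), `κ = 4`
otherwise — equivalently `B(ℓ)/2` is a square or twice a square according as the admissible primes are `A₃`- or transposition-Frobenii in
`ℚ(E[2])` (for `|Δ_E| = N^{odd}`, `(Δ_E/ℓ) = sgn(Δ_E)·ε₀` at every admissible `ℓ`; the factor `2` is the Tamagawa number `c_ℓ(E^{(−ℓ)}) = 2`).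
Census RM-6: 1336/1336 (`ε₀ = +1`: 570; `ε₀ = −1`: 766), `B > 0` on 1064/1064 non-zero values.  Why it might fail: a curve whose Shimura
lift `g` is imprimitive at 2 in the `u`-normalisation (extra rational 2-isogeny structure; none at prime level beyond `N ≤ 37`) would shift `κ`
by `4`. [cite: Kohnen1985, Cor. 1] [cite: Waldspurger1981Fourier, Thm. 1]
REF1-AUDIT §201: **SURVIVES as CONJECTURE** (exact 2-adic unit `κ ∈ {2,4}` keyed to `IsRectangularPeriodLattice f ↔ ε₀ = 1`; `ε₀ = ±1` forced by `(jacobiSym … : ℂ) = ε₀` with `ℓ ≠ N`); J2-IMMUNE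
(`#Ш` square by Cassels–Tate, `tors²` square, `Tam = 1` at prime level — the E-level shadow `B = κ·(n·tors/√(Tam·Ш))²` stays a square class).  R201g: `Waldspurger1981` is not a tree
key — the tag below uses the tree's `Waldspurger1981Fourier` (J. Math. Pures Appl. 60 (1981), the same paper).  REF2-PLACEMENT v53 §8.1 (A39-R2): `κ = 2 ⟺` admissible `ℓ` are
A₃-Frobenii `⟺ c_ℓ(E^{(−ℓ)}) ∈ {1,4}`; `κ = 4 ⟺` transpositions, `c_ℓ = 2` («the extra 2 in `i_f` IS the Tamagawa number of the twist»), consistent with the Pal 2012 period/Tamagawa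
reading.  Tagged `@[conjecture]`. -/
@[conjecture] def BirchSumSquareClassLaw : Prop :=
  ∀ (N : ℕ) [NeZero N] (f : CuspForm (Gamma0 N) 2) (ε₀ : ℤ), N.Prime → IsNewform0 f → coeffField f = ⊥ → IsFrickeEigen N f ε₀ →
    ∀ (u : ℚ), IsMinusPeriodUnit f u →
    ∀ (ℓ : ℕ) [NeZero ℓ] (B : ℤ), ℓ.Prime → ℓ % 4 = 3 → ℓ ≠ N → (jacobiSym (-(ℓ : ℤ)) N : ℂ) = ε₀ → IsBirchUnitValue f u ℓ B →
      ∃ c : ℤ, ((IsRectangularPeriodLattice f ↔ ε₀ = 1) → B = 2 * c ^ 2) ∧ (¬ (IsRectangularPeriodLattice f ↔ ε₀ = 1) → B = 4 * c ^ 2)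

/-- **AN-39h `BirchSumHeegnerIndexSquareLaw` (E-LEVEL, `ε₀ = +1`; Gross–Zagier ∘ Birch with the constant pinned: census RM-7 353/353 at
prime level, where `Tam(E) = #E(ℚ)_tors = 1`; composite square-free level (ENGINE RM2 `j330422`, 251/251 pairs): the same with the factor
`#E(ℚ)_tors²/Tam(E)`, i.e. `B(ℓ)·Tam(E) = 2·i_f·#E(ℚ)²_tors·n(ℓ)²`, constant per curve on 26 curves with `Tam ∈ {2,4}` or `tors = 2`).**
For the optimal rank-one curve of prime conductor `N` (so `Tam = tors = 1`) and an admissible prime `ℓ` with Heegner index `n(ℓ)`: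
`B(ℓ) = 2·i_f·n(ℓ)²`, `i_f = 1` if `Δ > 0` else `2`.  Why it might fail: it presumes `Ш(E)` invisible (`= 1` on the range); by GZ + BSD the
honest constant is `2 i_f tors²/(Tam·#Ш(E))`, so a rank-one prime-conductor curve with `Ш(E)[p] ≠ 0` breaks it — as a 2-ADIC statement under
the crux's hypotheses it is `ord₂ B(ℓ) = 1 + [Δ<0] + 2·ord₂ n(ℓ) − ord₂ #Ш(E)[2^∞]`, i.e. BSD₂-strength in the offset (see AN-39i).
REF1-AUDIT §201: **KILLED AS TYPED (mis-stated, J2)** — `B(ℓ) = 2i_f n(ℓ)²` fails at all 25 prime-conductor `Ш_an ≠ 1` curves (`B = 2i_f n²/Ш_an`), first 35083b1; the docstring's own «Why it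
might fail» names exactly this.  **THIS ROW IS REF1's REPAIRED FORM C′ (R201b MANDATORY), typed by -ty g18: `W.shaOrder = 1 →` inserted after `W.tamagawaProduct = 1 → W.torsionOrder = 1 →`.**
Then C′ = GZ ∘ Birch ∘ (BSD quotient of `E` = 1) — FULL-BSD-strength in the exact form, BSD₂ in the 2-adic form (REF2-PLACEMENT v53 §8 (8.1) «BSD₂-strength in its constant» confirmed
and sharpened); census RM-7 353/353 + RM2 251/251 where `Ш_an = 1`.  Tagged `@[conjecture]`.  R201e: predicted `B = 2i_f n²/4` at N ∈ {35083, 45979, 48731}. -/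
@[conjecture] def BirchSumHeegnerIndexSquareLaw : Prop :=
  ∀ (N : ℕ) [NeZero N] (W : WeierstrassCurve ℚ) [W.IsElliptic], N.Prime → W.conductorNorm ℤ = N → W.analyticRank = 1 →
    W.tamagawaProduct = 1 → W.torsionOrder = 1 → W.shaOrder = 1 →
    ∀ (Dt : ModularParametrizationData W N), IsOptimalDatum Dt → IsFrickeEigen N Dt.f 1 →
    ∀ (u : ℚ), IsMinusPeriodUnit Dt.f u →
    ∀ (ℓ : ℕ) [NeZero ℓ] (B : ℤ), ℓ.Prime → ℓ % 4 = 3 → ℓ ≠ N → jacobiSym (-(ℓ : ℤ)) N = 1 → IsBirchUnitValue Dt.f u ℓ B →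
    ∀ (K : Type) [Field K] [NumberField K], IsImaginaryQuadratic K → NumberField.discr K = -(ℓ : ℤ) →
    ∀ (H : HeegnerDatum N (NumberField.discr K)) (ι : K →+* ℂ) (P g : (W.baseChange K).toAffine.Point) (n : ℕ),
      WeierstrassCurve.Affine.Point.map ι.toRatAlgHom P = heegnerPointComplex Dt H →
      (∀ R : (W.baseChange K).toAffine.Point, ∃ z : ℤ, R - z • g ∈ AddCommGroup.torsion (W.baseChange K).toAffine.Point) →
      (P - (n : ℤ) • g ∈ AddCommGroup.torsion (W.baseChange K).toAffine.Point ∨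
        P + (n : ℤ) • g ∈ AddCommGroup.torsion (W.baseChange K).toAffine.Point) →
      B = (if 0 < W.Δ then 2 else 4) * (n : ℤ) ^ 2

/-- **AN-39i `HeegnerExponentBirchMeterAtTwo` (E-LEVEL DOOR METER; GZ-strength, BSD-free: the per-curve OFFSET `e` absorbs
`ord₂(Tam·#Ш/tors²)`).**  For a modular parametrisation of a rank-one curve of prime conductor with `f|W_N = f`, there is ONE integer offset
`e` such that at EVERY admissible prime door `ℓ` the 2-divisibility exponent of the Heegner point is read off the f-intrinsic Birch value:
`P_ℓ` is `2^m`-divisible up to torsion iff `2m ≤ ord₂(B(ℓ)/κ) + 2e` (`κ = 2` if `Δ > 0` else `4`).  With AN-39g, `ord₂(B(ℓ)/κ) = 2·ord₂ c(ℓ)`: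
the doors' exponents differ only through the PARITY PATTERN OF THE SHIMURA-LIFT COEFFICIENTS; a minimal door exists iff `e = 0` and some
admissible `c(ℓ)` is odd (census: 6/89 rank-one curves — `359a1, 359b1, 997a1, 3797a1, 4159a1, 4159b1`, all `Δ > 0`, `η_f = 0` — have every
`c(ℓ)`, `ℓ ≤ 100`, even: no minimal PRIME door, by AN-33's `a_ℓ`-parity law).  Why it might fail: `B(ℓ) = 0` doors (`n(ℓ) = 0`, twist of
analytic rank ≥ 2) must be excluded, as below; otherwise it is Gross–Zagier + Birch up to the rationality of `L'(E,1)/(Ω⁺ ĥ)`.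
REF1-AUDIT §201: **SURVIVES (GZ-strength, BSD-free)** — the per-`(W,Dt,u)` offset `∃ e : ℤ` absorbs BOTH J1 (`e ↦ e+1`) and J2 (`e ↦ e + ord₂(tors²/(Tam·Ш))/…`); `B ≠ 0` excludes torsion Heegner
points (`W.analyticRank = 1` ⟹ `y_K` non-torsion iff `L(E^{(−ℓ)},1) ≠ 0` iff `B ≠ 0`, GZ).  R201d (hygiene, NOT applied — verbatim): `padicValInt 2 (B / κ)` is floor-division junk when
`κ ∤ B` (`(-7)/2 = −4`); a prover may re-type as `padicValInt 2 B = 2*m + (1|2) − 2*e` or add `(κ : ℤ) ∣ B →` (AN-39g gives `κ ∣ B`).  REF2-PLACEMENT v53 §8.2: this is GROSS–ZAGIER ITSELF plus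
Birch's formula (tree `ratMinusTwistedSymbolSum_jacobiChar_mul_minusPeriod`): `n(ℓ)² = B_f(ℓ)·[ℓ-FREE bracket]·(lattice index)⁻²` ⟹ `e_E` exists — COROLLARY OF PRINT
([cite: GrossZagier1986, I.(6.3)] + Birch), BSD-free, theorem-shaped modulo the tree's GZ constant and the (bounded, ℓ-independent under odd tors) lattice index; «`e_E = 0 ⟺`
BSD₂-exactness for E» is what is left.  Plain `def`. -/
def HeegnerExponentBirchMeterAtTwo : Prop :=
  ∀ (N : ℕ) [NeZero N] (W : WeierstrassCurve ℚ) [W.IsElliptic], N.Prime → W.conductorNorm ℤ = N → W.analyticRank = 1 →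
    ∀ (Dt : ModularParametrizationData W N), IsFrickeEigen N Dt.f 1 → ∀ (u : ℚ), IsMinusPeriodUnit Dt.f u →
    ∃ e : ℤ, ∀ (ℓ : ℕ) [NeZero ℓ] (B : ℤ), ℓ.Prime → ℓ % 4 = 3 → ℓ ≠ N → jacobiSym (-(ℓ : ℤ)) N = 1 →
      IsBirchUnitValue Dt.f u ℓ B → B ≠ 0 →
      ∀ (K : Type) [Field K] [NumberField K], IsImaginaryQuadratic K → NumberField.discr K = -(ℓ : ℤ) →
      ∀ (H : HeegnerDatum N (NumberField.discr K)) (ι : K →+* ℂ) (P : (W.baseChange K).toAffine.Point) (m : ℕ),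
        WeierstrassCurve.Affine.Point.map ι.toRatAlgHom P = heegnerPointComplex Dt H →
        HasTwoDivisibilityUpToTorsion W K P m →
        (2 * m : ℤ) = padicValInt 2 (B / (if 0 < W.Δ then 2 else 4)) + 2 * e

/-- **AN-39j `BirchValueKummerLocalisationLawAtTwo` (the `Δ < 0` MINIMAL-DOOR BIT; CONJECTURE as an f ↔ E law, both sides computable
per instance; census T-RM10: 256/256 at prime level, `ℓ ≤ 100`).**  For the optimal rank-one curve of prime conductor `N` with `Δ < 0`
(`Tam = tors = 1`), an admissible prime `ℓ` is a TRANSPOSITION Frobenius in `ℚ(E[2])` (`(Δ/ℓ) = −1`), so `E(ℚ_ℓ)/2E(ℚ_ℓ) ≅ ℤ/2`; the law: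
`B_f(ℓ)/4` is odd **iff** the generator `g` of `E(ℚ)/tors` is NOT divisible by `2` in `E(ℚ_ℓ)` (equivalently its reduction is a non-double in
`E(𝔽_ℓ)`; equivalently, by Mazur–Rubin's one-place twisting count, `Sel₂(E^{(−ℓ)}/ℚ) = 0`).  With RM-7 (`B = 4 n(ℓ)²` at `Δ<0`) this says
`n(ℓ) odd ⟺ loc_ℓ κ(g) ≠ 0` (112+95 vs 23+26 at `ℓ ≡ 3, 7 (mod 8)`: NO condition at `2`).  Its `Δ > 0` twin is §20's `η_f`-law with `η_f` =
the EGG BIT of the generator (`a_ℓ` odd: `n(ℓ)` odd iff `g ∉ E⁰(ℝ)`, 149/149; `a_ℓ` even: `n(ℓ)` even, 52/52).  Print decomposition: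
(⟹) = Kato's divisibility at `p = 2` for the rank-0 twist + Mazur–Rubin; (⟸) = the `p = 2` rank-0 converse with exact valuation for prime
twists of a general big-image curve — ask REF2 (T-an-92).  Why it might fail: a curve with `Ш(E)[2] ≠ 0` or non-trivial Manin constant shifts
the left side by an even power only if RM-8's offset is even; at `ℓ ≡ 3 (mod 8)` a local condition at `2` could enter for even `N`.
REF1-AUDIT §201: **SURVIVES as CONJECTURE only WITH a `Ш(E)[2] = 0` binder (R201b MANDATORY); AS SKETCHED it is BSD₂-INCONSISTENT at the 10 `Δ < 0`, `Ш_an = 4` prime-conductor curves**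
(35083b1, 48731a1, 92419a1, 106979a1, 147151b1, 230819a1, 236707a1, 458947a1/c1; there `dim Sel₂(E) = 3`, Mazur–Rubin's one-place count gives `dim Sel₂(E^{(−ℓ)}) ∈ {2,4}`, so under BSD₂
`ord₂ B(ℓ) ≥ 4` and `Odd (B/4)` NEVER holds, while the right side holds on a Chebotarev-positive set).  **THIS ROW IS REF1's REPAIRED FORM C′, typed by -ty g18: `Nat.card
(AddCommGroup.primaryComponent W.sha 2) = 1 →` inserted after `W.tamagawaProduct = 1 → W.torsionOrder = 1 →`.**  R201d (typing trap, NOT applied): for ODD `n`, `Odd (n²/4)` is FALSE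
(`bc7_odd_sq_div_four`); here `Δ < 0 ⟹ κ = 4 ∣ B` (AN-39g), so `Odd (B / 4)` reads correctly; a prover may prefer `4 ∣ B ∧ ¬ 8 ∣ B`.  With the binder: the law is the `Δ < 0`
minimal-door bit (T-RM10 256/256).  REF2-PLACEMENT v53 §8.3 (T-an-92): AN-39j = [e1 print/tree: descent bit ⟺ `Sel₂(E^{(−ℓ)}/ℚ) = 0` (`GenusKolyArch.eggTwistLawAtTwo_holds`,
`RankOneAtTwoOneDoor.exists_selmerTrivialMinimalDoor`; Kramer 1981 / Mazur–Rubin 2010)] ∘ [e2 «`n(ℓ)` odd ⟺ `Sel₂(E^{(−ℓ)}) = 0`»: NOT IN PRINT in either direction at `p = 2`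
([cite: KrizLi2019, Rem. 1.14] «the p-converse … for p = 2 is not known»; Kolyvagin/Gross 1991 exactness excludes `p = 2`) = the layer-0 face of R₀⁺ and its converse] ∘ [e3
«`B_f(ℓ)/κ` odd ⟺ `Sel₂(E^{(−ℓ)}) = 0`»: NOT IN PRINT — (⟹) conditional route: Kato-type divisibility at 2, open for S₃-image (MEMO-imc); (⟸): no print; cf. [cite: Zhai2016] (rank-0
base), [cite: KrizLi2019, Thm. 5.1]] — a LAW-CANDIDATE BEYOND PRINT, decidable per instance on both sides (405/405); -an's «sharpest beyond-print candidate» claim STANDS on REF2's search.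
Tagged `@[conjecture]`. -/
@[conjecture] def BirchValueKummerLocalisationLawAtTwo : Prop :=
  ∀ (N : ℕ) [NeZero N] (W : WeierstrassCurve ℚ) [W.IsElliptic], N.Prime → W.conductorNorm ℤ = N → W.analyticRank = 1 → W.Δ < 0 →
    W.tamagawaProduct = 1 → W.torsionOrder = 1 → Nat.card (AddCommGroup.primaryComponent W.sha 2) = 1 →
    ∀ (Dt : ModularParametrizationData W N), IsOptimalDatum Dt → IsFrickeEigen N Dt.f 1 → ∀ (u : ℚ), IsMinusPeriodUnit Dt.f u →
    ∀ (ℓ : ℕ) [Fact ℓ.Prime] [NeZero ℓ] (B : ℤ), ℓ % 4 = 3 → ℓ ≠ N → jacobiSym (-(ℓ : ℤ)) N = 1 → IsBirchUnitValue Dt.f u ℓ B →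
    ∀ (g : (W.baseChange ℚ).toAffine.Point),
      (∀ R : (W.baseChange ℚ).toAffine.Point, ∃ z : ℤ, R - z • g ∈ AddCommGroup.torsion (W.baseChange ℚ).toAffine.Point) →
      (Odd (B / 4) ↔ ¬ ∃ Q : (W.baseChange ℚ_[ℓ]).toAffine.Point,
        WeierstrassCurve.Affine.Point.map (algebraMap ℚ ℚ_[ℓ]).toRatAlgHom g = 2 • Q)

/-- **AN-39k `RMGenusSumSignLaw` (THETA-FREE SHIMURA LIFT; CONJECTURE with the GKZ II Thm C shape in print, sign/constant pinned by census
T-RM12: the sign of `Σχ k` is `β`-independent on 4 547 pairs and equals `−σ_f(ℓ₁)σ_f(ℓ₂)` — 2 836 independent cycle checks on 489 curves,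
0 conflicts).**  For each `f` there is a sign function `σ_f` on the admissible primes such that for every admissible pair the RM genus sum is
`−σ_f(ℓ₁)σ_f(ℓ₂)·√(B_f(ℓ₁)B_f(ℓ₂))` (the square root is an integer by AN-39f/g); i.e. `c_f(ℓ) := σ_f(ℓ)√(B_f(ℓ)/κ)` are weight-`3/2`
Fourier coefficients up to one global sign, computed from weight-`2` modular symbols alone.  Why it might fail: a second genus-type character
(e.g. at `2`, for `ℓ ≡ 3` vs `7 (mod 8)`) could enter the sign at composite or even level; the law is stated at prime level.
REF1-AUDIT §201: **SURVIVES as CONJECTURE** (GKZ-II Thm C shape; `σ` chosen per `(f,u)` after `ε₀`; asserts β-independence of the sign — census T-RM12 4 547 pairs / 2 836 cycle checks, 0 conflicts);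
f-intrinsic ⟹ J1/J2-immune; the orientation convention is fixed by `rmAutomorphCusp` (`γ_Q`, not `γ_Q⁻¹`) ✓.  REF2-PLACEMENT v53 §8.1: = [cite: GrossKohnenZagier1987, Thm. C] (GKZ II) shape,
acq-06812 for the printed constant.  Tagged `@[conjecture]`. -/
@[conjecture] def RMGenusSumSignLaw : Prop :=
  ∀ (N : ℕ) [NeZero N] (f : CuspForm (Gamma0 N) 2) (ε₀ : ℤ), N.Prime → IsNewform0 f → coeffField f = ⊥ → IsFrickeEigen N f ε₀ →
    ∀ (u : ℚ), IsMinusPeriodUnit f u → ∃ σ : ℕ → ℤ, (∀ ℓ, σ ℓ = 1 ∨ σ ℓ = -1) ∧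
    ∀ (ℓ₁ ℓ₂ : ℕ) [NeZero ℓ₁] [NeZero ℓ₂] (β : ℤ) (S : Finset (ℤ × ℤ × ℤ)) (t w : ℤ) (ε : ℤ × ℤ × ℤ → ℤ) (k : ℤ × ℤ × ℤ → ℤ)
      (B₁ B₂ : ℤ), ℓ₁.Prime → ℓ₂.Prime → ℓ₁ % 4 = 3 → ℓ₂ % 4 = 3 → ℓ₁ ≠ ℓ₂ → ℓ₁ ≠ N → ℓ₂ ≠ N →
      (jacobiSym (-(ℓ₁ : ℤ)) N : ℂ) = ε₀ → (jacobiSym (-(ℓ₂ : ℤ)) N : ℂ) = ε₀ →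
      IsRMPairDatum f u ℓ₁ ℓ₂ β S t w ε k → IsBirchUnitValue f u ℓ₁ B₁ → IsBirchUnitValue f u ℓ₂ B₂ →
      ∃ r : ℤ, 0 ≤ r ∧ r ^ 2 = B₁ * B₂ ∧ rmGenusSum S ε k = -(σ ℓ₁ * σ ℓ₂ * r)

end Summit.BirchSwinnertonDyer.Rank1Residual.F1Sign2.ANg22
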